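import Mathlib

/-!
# Finite reversal principle: a Kelvin-symmetric two-sided specification forces `θ`-reversibility
# (negative-side support for crux `stmt-CriticalPhenomena-4801`, card `annulus-kelvin-symmetry-scale-axis-gibbs`)

Support file of the crux disprover (cdisprove seat, cycle 2). The card's GLOBAL ENGINE along the scale axis is
one-dimensional Gibbs uniqueness: a stationary Markov law whose TWO-SIDED specification ("law of the middle given
both neighbours") is symmetric under an involution `θ` composed with time reversal must itself be `θ`-reversible.
Its finite shadow was published as the Prop `reversible_of_unique_symmetric_spec` in
`Cruxes/MoebiusLimitOfTwoPointLaw/Sketch.lean`; it is PROVED here verbatim (`reversible_of_symmetric_twoSidedSpec`),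
for finite state spaces with strictly positive kernel:

* the two-sided specification `P_ab P_bc / (P²)_ac` determines a positive stochastic matrix uniquely (two kernels
  with the same specification differ by a Doob `h`-transform, and a positive stochastic matrix has no positive
  eigenvector other than the constants — a Perron argument on the `argmax`/`argmin` of `h`);
* the `θ`-conjugate time reversal `Q_ab = π_{θb} P_{θb,θa} / π_{θa}` is stochastic and has the mirrored
  specification, so Kelvin symmetry of the specification gives `Q = P`;
* the stationary law of a positive kernel is unique up to normalisation, whence `π ∘ θ = π` and
  `π_a P_ab = π_{θb} P_{θb,θa}`.

No Ising input; pure finite Markov-chain algebra, `sorry`-free. (The infinite-volume / continuum version — the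
card's LKS ⇒ inversion covariance — is of course NOT addressed here.)
-/

namespace Summit.CriticalPhenomena.Ising3DConformalLimit.Theorems.MoebiusLimitOfTwoPointLaw.Negative

open Finset

section Markov

variable {S : Type*} [Fintype S]

/-- **Perron step.** A positive stochastic matrix has no positive "eigenvector" with eigenvalue `1/K` other than
the constants, and then `K = 1`: if `∑_y P x y · g y = g x / K` for all `x` with `P, g, K > 0`, then `K = 1` and
`g` is constant. -/
theorem eq_one_and_const_of_positive_eigenvector (P : S → S → ℝ) (g : S → ℝ) (K : ℝ)
    (hP : ∀ a b, 0 < P a b) (hrow : ∀ a, ∑ b, P a b = 1) (hg : ∀ a, 0 < g a) (hK : 0 < K)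
    (heig : ∀ x, ∑ y, P x y * g y = g x / K) (a₀ : S) :
    K = 1 ∧ ∀ y, g y = g a₀ := by
  have hne : (univ : Finset S).Nonempty := ⟨a₀, mem_univ _⟩
  obtain ⟨xmax, -, hmax⟩ := exists_max_image univ g hne
  obtain ⟨xmin, -, hmin⟩ := exists_min_image univ g hne
  -- `g xmax / K ≤ g xmax` and `g xmin / K ≥ g xmin`
  have h1 : g xmax / K ≤ g xmax := by
    rw [← heig xmax]
    calc ∑ y, P xmax y * g y ≤ ∑ y, P xmax y * g xmax :=
          sum_le_sum fun y _ => mul_le_mul_of_nonneg_left (hmax y (mem_univ _)) (hP _ _).le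
      _ = g xmax := by rw [← sum_mul, hrow, one_mul]
  have h2 : g xmin ≤ g xmin / K := by
    rw [← heig xmin]
    calc g xmin = ∑ y, P xmin y * g xmin := by rw [← sum_mul, hrow, one_mul]
      _ ≤ ∑ y, P xmin y * g y :=
          sum_le_sum fun y _ => mul_le_mul_of_nonneg_left (hmin y (mem_univ _)) (hP _ _).le
  have hK1 : K = 1 := by
    have hgx := hg xmax
    have hgn := hg xmin
    have hle : 1 ≤ K := by
      -- from h1: g/K ≤ g with g > 0
      rw [div_le_iff₀ hK] at h1
      nlinarith
    have hge : K ≤ 1 := by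
      rw [le_div_iff₀ hK] at h2
      nlinarith
    linarith
  refine ⟨hK1, ?_⟩
  -- with `K = 1`: `∑ P xmax y (g xmax - g y) = 0`, all terms nonnegative
  have hsum : ∑ y, P xmax y * (g xmax - g y) = 0 := by
    have e : ∑ y, P xmax y * (g xmax - g y) = (∑ y, P xmax y) * g xmax - ∑ y, P xmax y * g y := by
      rw [sum_mul, ← sum_sub_distrib]
      refine sum_congr rfl fun y _ => ?_
      ring
    rw [e, hrow, heig xmax, hK1, one_mul, div_one, sub_self]
  have hterm : ∀ y ∈ (univ : Finset S), P xmax y * (g xmax - g y) = 0 :=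
    (sum_eq_zero_iff_of_nonneg fun y _ =>
      mul_nonneg (hP _ _).le (sub_nonneg.2 (hmax y (mem_univ _)))).1 hsum
  have hall : ∀ y, g y = g xmax := by
    intro y
    have := hterm y (mem_univ _)
    rcases mul_eq_zero.1 this with h | h
    · exact absurd h (hP _ _).ne'
    · linarith
  intro y
  rw [hall y, hall a₀]

/-- **Uniqueness of the stationary law** of a positive kernel, up to normalisation: `ν P = ν`, `π P = π`,
`π > 0` and `∑ ν = ∑ π` force `ν = π` (no sign assumption on `ν`: compare `ν/π` at its maximum). -/
theorem stationary_unique (P : S → S → ℝ) (π ν : S → ℝ)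
    (hP : ∀ a b, 0 < P a b) (hπ : ∀ a, 0 < π a)
    (hstatπ : ∀ b, ∑ a, π a * P a b = π b) (hstatν : ∀ b, ∑ a, ν a * P a b = ν b)
    (hmass : ∑ a, ν a = ∑ a, π a) (a₀ : S) : ∀ a, ν a = π a := by
  have hne : (univ : Finset S).Nonempty := ⟨a₀, mem_univ _⟩
  set r : S → ℝ := fun a => ν a / π a with hr
  have hνr : ∀ a, ν a = r a * π a := fun a => by rw [hr]; field_simp [(hπ a).ne']
  obtain ⟨xmax, -, hmax⟩ := exists_max_image univ r hne
  -- `ν xmax = ∑ r a π a P a xmax ≤ r xmax ∑ π a P a xmax = r xmax π xmax = ν xmax`: equality termwise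
  have hsum : ∑ a, (r xmax - r a) * (π a * P a xmax) = 0 := by
    have e : ∑ a, (r xmax - r a) * (π a * P a xmax) =
        r xmax * ∑ a, π a * P a xmax - ∑ a, ν a * P a xmax := by
      rw [mul_sum, ← sum_sub_distrib]
      refine sum_congr rfl fun a _ => ?_
      rw [hνr a]; ring
    rw [e, hstatπ, hstatν, hνr xmax, sub_self]
  have hterm : ∀ a ∈ (univ : Finset S), (r xmax - r a) * (π a * P a xmax) = 0 :=
    (sum_eq_zero_iff_of_nonneg fun a _ =>
      mul_nonneg (sub_nonneg.2 (hmax a (mem_univ _))) (mul_pos (hπ a) (hP _ _)).le).1 hsum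
  have hconst : ∀ a, r a = r xmax := by
    intro a
    rcases mul_eq_zero.1 (hterm a (mem_univ _)) with h | h
    · linarith
    · exact absurd h (mul_pos (hπ a) (hP _ _)).ne'
  -- normalisation: `r xmax = 1`
  have hr1 : r xmax = 1 := by
    have e : ∑ a, ν a = r xmax * ∑ a, π a := by
      rw [mul_sum]
      exact sum_congr rfl fun a _ => by rw [hνr a, hconst a]
    have hpos : 0 < ∑ a, π a := sum_pos (fun a _ => hπ a) hne
    have : r xmax * ∑ a, π a = 1 * ∑ a, π a := by rw [← e, hmass, one_mul]
    exact mul_right_cancel₀ hpos.ne' this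
  intro a
  rw [hνr a, hconst a, hr1, one_mul]

/-- **Reversal principle (finite shadow), verbatim the Prop `reversible_of_unique_symmetric_spec` of
`Cruxes/MoebiusLimitOfTwoPointLaw/Sketch.lean`, PROVED.** For a finite state space with an involution `θ` and a
strictly positive stationary Markov law `(π, P)` whose two-sided specification is Kelvin-symmetric,
`γ(b ∣ a, c) = γ(θb ∣ θc, θa)`, the law is `θ`-reversible: `π_a P_ab = π_{θb} P_{θb,θa}`. -/
theorem reversible_of_symmetric_twoSidedSpec (θ : S ≃ S) (π : S → ℝ) (P : S → S → ℝ)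
    (hπ : ∀ a, 0 < π a) (hP : ∀ a b, 0 < P a b)
    (hrow : ∀ a, ∑ b, P a b = 1) (hstat : ∀ b, ∑ a, π a * P a b = π b)
    (hsym : ∀ a b c : S,
      π a * P a b * P b c / (∑ b', π a * P a b' * P b' c) =
        π (θ c) * P (θ c) (θ b) * P (θ b) (θ a) / (∑ b', π (θ c) * P (θ c) b' * P b' (θ a))) :
    ∀ a b : S, π a * P a b = π (θ b) * P (θ b) (θ a) := by
  intro a₀ b₀
  have hne : (univ : Finset S).Nonempty := ⟨a₀, mem_univ _⟩
  have hπne : ∀ a, π a ≠ 0 := fun a => (hπ a).ne'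
  have hP2pos : ∀ a c, 0 < ∑ b, P a b * P b c := fun a c =>
    sum_pos (fun b _ => mul_pos (hP _ _) (hP _ _)) hne
  -- (1) the two-sided specification with `π` cancelled
  have hspec : ∀ a b c, P a b * P b c / (∑ b', P a b' * P b' c) =
      P (θ c) (θ b) * P (θ b) (θ a) / (∑ b', P (θ c) b' * P b' (θ a)) := by
    intro a b c
    have h := hsym a b c
    have e1 : ∑ b', π a * P a b' * P b' c = π a * ∑ b', P a b' * P b' c := by
      rw [mul_sum]; exact sum_congr rfl fun b' _ => by ring
    have e2 : ∑ b', π (θ c) * P (θ c) b' * P b' (θ a) = π (θ c) * ∑ b', P (θ c) b' * P b' (θ a) := by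
      rw [mul_sum]; exact sum_congr rfl fun b' _ => by ring
    rw [e1, e2, mul_assoc, mul_assoc, mul_div_mul_left _ _ (hπne a), mul_div_mul_left _ _ (hπne (θ c))] at h
    exact h
  -- (2) the θ-conjugate time reversal `Q` and its specification
  set Q : S → S → ℝ := fun a b => π (θ b) * P (θ b) (θ a) / π (θ a) with hQ
  have hQpos : ∀ a b, 0 < Q a b := fun a b => div_pos (mul_pos (hπ _) (hP _ _)) (hπ _)
  have hQQ : ∀ a b c, Q a b * Q b c = π (θ c) / π (θ a) * (P (θ c) (θ b) * P (θ b) (θ a)) := by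
    intro a b c
    have h1 := hπne (θ a)
    have h2 := hπne (θ b)
    simp only [hQ]
    field_simp
  have hQ2 : ∀ a c, ∑ b', Q a b' * Q b' c = π (θ c) / π (θ a) * ∑ b, P (θ c) b * P b (θ a) := by
    intro a c
    rw [show (∑ b', Q a b' * Q b' c) = ∑ b', π (θ c) / π (θ a) * (P (θ c) (θ b') * P (θ b') (θ a)) from
      sum_congr rfl fun b' _ => hQQ a b' c, ← mul_sum]
    congr 1
    exact Equiv.sum_comp θ (fun b => P (θ c) b * P b (θ a))
  have hQ2pos : ∀ a c, 0 < ∑ b', Q a b' * Q b' c := fun a c =>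
    sum_pos (fun b _ => mul_pos (hQpos _ _) (hQpos _ _)) hne
  have hE : ∀ a b c, Q a b * Q b c / (∑ b', Q a b' * Q b' c) = P a b * P b c / (∑ b', P a b' * P b' c) := by
    intro a b c
    rw [hQQ, hQ2, mul_div_mul_left _ _ (div_pos (hπ _) (hπ _)).ne', hspec a b c]
  -- (3) the ratio `R = Q/P` factorises through a two-step quantity
  set R : S → S → ℝ := fun a b => Q a b / P a b with hR
  have hRpos : ∀ a b, 0 < R a b := fun a b => div_pos (hQpos _ _) (hP _ _)
  have hRR : ∀ a b c, R a b * R b c = (∑ b', Q a b' * Q b' c) / (∑ b', P a b' * P b' c) := by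
    intro a b c
    have cross := (div_eq_div_iff (hQ2pos a c).ne' (hP2pos a c).ne').1 (hE a b c)
    simp only [hR]
    rw [div_mul_div_comm, div_eq_div_iff (mul_pos (hP a b) (hP b c)).ne' (hP2pos a c).ne']
    linear_combination cross
  -- hence `R a b * R b c` does not depend on `b`
  have e1 : ∀ x y, R x y * R y b₀ = R x b₀ * R b₀ b₀ := fun x y => (hRR x y b₀).trans (hRR x b₀ b₀).symm
  -- (4) rank one: `R x y = (K / g x) * g y` with `g y = R a₀ y / R a₀ b₀`, `K = R b₀ b₀`
  set g : S → ℝ := fun y => R a₀ y / R a₀ b₀ with hg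
  have hgpos : ∀ y, 0 < g y := fun y => div_pos (hRpos _ _) (hRpos _ _)
  set K : ℝ := R b₀ b₀ with hK
  have hKpos : 0 < K := hRpos _ _
  have hfac : ∀ x y, R x y = K / g x * g y := by
    intro x y
    have ex := e1 x y
    have ea := e1 a₀ y
    have hx : g x * R x b₀ = K := by
      have h0 := e1 a₀ x
      simp only [hg, hK]
      rw [div_mul_eq_mul_div, div_eq_iff (hRpos a₀ b₀).ne']
      linarith
    have h3 : (R x y * R a₀ b₀ - R x b₀ * R a₀ y) * R y b₀ = 0 := by
      linear_combination R a₀ b₀ * ex - R x b₀ * ea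
    have h4 : R x y * R a₀ b₀ = R x b₀ * R a₀ y := by
      have := (mul_eq_zero.1 h3).resolve_right (hRpos y b₀).ne'
      linarith
    have hgx : g x ≠ 0 := (hgpos x).ne'
    have hKg : K / g x = R x b₀ := by
      rw [div_eq_iff hgx]
      linarith
    rw [hKg]
    simp only [hg]
    rw [mul_div_assoc', eq_div_iff (hRpos a₀ b₀).ne']
    linarith
  -- (5) row sums of `Q` are `1`, so `g` is a positive eigenvector of `P` with eigenvalue `1/K`
  have hQrow : ∀ x, ∑ y, Q x y = 1 := by
    intro x
    simp only [hQ]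
    rw [← sum_div, Equiv.sum_comp θ (fun z => π z * P z (θ x)), hstat, div_self (hπne _)]
  have heig : ∀ x, ∑ y, P x y * g y = g x / K := by
    intro x
    have h1 : ∑ y, Q x y = ∑ y, K / g x * (P x y * g y) := by
      refine sum_congr rfl fun y _ => ?_
      have : Q x y = R x y * P x y := by
        simp only [hR]; rw [div_mul_cancel₀ _ (hP x y).ne']
      rw [this, hfac x y]; ring
    rw [hQrow x, ← mul_sum] at h1
    have hgx := hgpos x
    field_simp
    field_simp at h1
    linarith
  -- (6) Perron: `K = 1` and `g` constant, hence `R ≡ 1`, i.e. `Q = P`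
  obtain ⟨hK1, hgconst⟩ := eq_one_and_const_of_positive_eigenvector P g K hP hrow hgpos hKpos heig b₀
  have hgb : g b₀ = 1 := by simp only [hg]; exact div_self (hRpos _ _).ne'
  have hQP : ∀ x y, π (θ y) * P (θ y) (θ x) = π (θ x) * P x y := by
    intro x y
    have h1 : R x y = 1 := by rw [hfac x y, hgconst x, hgconst y, hgb, hK1]; norm_num
    simp only [hR, hQ] at h1
    rw [div_div, div_eq_one_iff_eq (mul_pos (hπ _) (hP _ _)).ne'] at h1
    linarith
  -- (7) `π ∘ θ` is stationary, hence equal to `π`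
  have hstat' : ∀ y, ∑ x, π (θ x) * P x y = π (θ y) := by
    intro y
    rw [show (∑ x, π (θ x) * P x y) = ∑ x, π (θ y) * P (θ y) (θ x) from sum_congr rfl fun x _ => (hQP x y).symm,
      ← mul_sum, Equiv.sum_comp θ (fun z => P (θ y) z), hrow, mul_one]
  have hmass : ∑ x, π (θ x) = ∑ x, π x := Equiv.sum_comp θ π
  have hπθ : ∀ a, π (θ a) = π a := stationary_unique P π (fun a => π (θ a)) hP hπ hstat hstat' hmass a₀
  -- (8) conclusion
  rw [hQP a₀ b₀, hπθ a₀]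

/-- The verbatim Prop `reversible_of_unique_symmetric_spec` of `Cruxes/MoebiusLimitOfTwoPointLaw/Sketch.lean`
(card `annulus-kelvin-symmetry-scale-axis-gibbs`) HOLDS (the involutivity hypothesis is not even needed). -/
theorem reversible_of_unique_symmetric_spec_holds :
    ∀ (S : Type) [Fintype S] [DecidableEq S] (θ : S ≃ S) (π : S → ℝ) (P : S → S → ℝ),
      Function.Involutive θ →
      (∀ a, 0 < π a) → (∀ a b, 0 < P a b) → (∀ a, ∑ b, P a b = 1) → (∀ b, ∑ a, π a * P a b = π b) →
      (∀ a b c : S,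
        π a * P a b * P b c / (∑ b', π a * P a b' * P b' c) =
          π (θ c) * P (θ c) (θ b) * P (θ b) (θ a) / (∑ b', π (θ c) * P (θ c) b' * P b' (θ a))) →
      ∀ a b : S, π a * P a b = π (θ b) * P (θ b) (θ a) :=
  fun _ _ _ θ π P _ hπ hP hrow hstat hsym => reversible_of_symmetric_twoSidedSpec θ π P hπ hP hrow hstat hsym

end Markov

end Summit.CriticalPhenomena.Ising3DConformalLimit.Theorems.MoebiusLimitOfTwoPointLaw.Negative
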